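import Summits.HodgeConjecture.HodgeConjecture.Theorems.Ring2AbelianAllStandardAKleimanLowering
import Summits.HodgeConjecture.HodgeConjecture.Theorems.Ring2HypothesesDescentMotivatedOnePolarisation
import Summits.HodgeConjecture.HodgeConjecture.Theorems.Ring2AbelianAllStandardAPencils
import Literature.AlgebraicGeometry.HodgeTheory.GysinBaseChangeOfKunneth
import HarnessLib

/-!
# Ring 2 · §AbelianAll (seat `ab-andre-1`), XIV-f — `A(X × X) ⟹ B⋆(X)` ON THE REAL CARRIERS (Kleiman 1968 Thm. 2.9,
# the `A ⟹ B` half of Grothendieck's letter circle `A(all X) ⟺ B(all X)`), by Kleiman's lowering operator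
# `Λ = ½ ((Λ ⊗ 1 + 1 ⊗ Λ)[Δ])_*`; and the letter circle `(∀ X, A(X)) ⟺ (∀ X, B⋆(X))` closed in the tree

HONEST FRAMING: research route, not a corollary; conditional on HC_CM plus one named minimal statement.
(Cell line: research route conditional on HC_CM; not a corollary; Q11.4-sentence-2 already refuted in dim ≥ 3.)
This file proves NO case of the Hodge conjecture and NO standard conjecture. It proves, unconditionally and on the
cell's REAL carriers (`complexBetti`, `algebraicClasses`/`supportedClasses`, `StandardConjectureA`,
`StandardConjectureBStar`, `IsAlgebraicCorrespondence`), the printed implication between two OPEN statements about one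
smooth projective `X/ℂ` of dimension `n` with a polarisation class `η`:

  `standardConjectureBStar_of_standardConjectureA_tensor_self :
     A(X ⊗ X, η ⊠ 1 + 1 ⊠ η) → B⋆(X, η)`,

the node "`A(X × X) ⟹ B(X)` — in print (Grothendieck 1969 §3 p. 196; Kleiman 1968 Thm. 2.9; Kleiman 1994 Thm. 4-1),
not in tree" of the §AbelianAll implication table, and with part XIV's `standardConjectureA_of_standardConjectureBStar`
(`B⋆(X) ⟹ A(X)` per variety) the LETTER CIRCLE on the real carriers:

  `forall_standardConjectureA_iff_forall_standardConjectureBStar :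
     (∀ X η, A(X, η)) ↔ (∀ X η, B⋆(X, η))`   (smooth projective `X/ℂ`, polarisation classes `η`).

MATHEMATICS (Kleiman's proof, ported by hand to the carriers; the abstract-Weil-cohomology version of the tree,
`Literature.AlgebraicGeometry.Motives.StandardConjecturesLefschetzOfHomNumProofs`, has no bridge to `complexBetti`):
let `Λ` be the lowering operator of `η` with the `𝔰𝔩₂` string formulas (b05's `exists_sl2Lowering`) and
`Λ₁₂ = Λ ⊗ 1 + 1 ⊗ Λ` its Künneth lift to `X × X` (`exists_kunnethLowering`), which satisfies `[L_θ, Λ₁₂] = deg - 2n`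
for `θ = η ⊠ 1 + 1 ⊠ η` (`prod_sl2_lefschetz_lowering_sub`).
Part (1), `Ring2AbelianAllStandardAKleimanLowering`, supplies: (P) an operator with the `𝔰𝔩₂` relation kills what
`L^{w+1}` kills; (β) under `A(Y, ω)` such an operator maps `Nᵖ H²ᵖ(Y)` into `Nᵖ⁻¹ H²ᵖ⁻²(Y)`; the cup-self-adjointness
`c ∪ Λ y = Λ c ∪ y`; (δ) the iterates `Λʳ : H^{n+r} → H^{n-r}` are injective, and algebraic once `Λ` is. Here:
* §1 on `X × X`: a cross product acts by zero in mismatched degrees; the INTERTWINING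
  `(Λ₁₂ γ)_* c = Λ (γ_* c) + γ_* (Λ c)` (Künneth span induction, ab-andre-2's cross functional `τ`, and the
  self-adjointness); the diagonal `[Δ] = (𝟙, 𝟙)_* 1` acts as the identity;
* §2 (γ)+(δ): `[Δ]` is algebraic, `Λ₁₂ [Δ]` is algebraic by (β) applied to `(X × X, θ, A(X × X, θ))`, so
  `Λ = ½ (Λ₁₂ [Δ])_*` is an algebraic correspondence in every degree (§1), hence so are the injective `Λʳ` ((δ)), and
  ab-andre-2's `ν`-criterion `standardConjectureBStar_of_nu` (XXII-b) gives `B⋆(X, η)`; then the letter circle.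

COUNT ONCE — used BY NAME, not restated: part (1) (`sl2_lowering_mem_algebraicClasses_of_standardConjectureA`,
`sl2Lowering_cupProduct_comm`, `exists_injective_algebraic_sl2LoweringPow`); b05 (`…ExteriorSumSl2Lowering/KunnethSl2/
ExteriorSumSl2Relation/ExteriorSumHardLefschetz`): `exists_sl2Lowering`, `exists_kunnethLowering`, `kunneth_span_induction`,
`prod_sl2_lefschetz_lowering_sub`, `prod_sl2_lowering_lefschetz_of_le_one`, `isPolarizationClass_boxSum`; ab-andre-2
(XXII-b/e, Lieberman–Fourier): `Hypotheses.standardConjectureBStar_of_nu`, `IsAlgebraicCorrespondence.smul`,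
`isAlgebraicCorrespondence_corrAction_complex`, `exists_crossFunctional`; ab-andre-1 XIV:
`standardConjectureA_of_standardConjectureBStar`; Literature: `corrAction_apply`, `corrAction_eq_corrClassAction`,
`corrClassAction_graph`, `complexGysin_graph_one_mem_algebraicClasses`, `complexGysin_cup_map_eq_zero_of_lt`,
`cupProduct_gradedComm_holds`, `cupProduct_assoc`, `complexBetti.map_cupProduct`, `complexBetti.map_id`,
`subsingleton_complexBetti`.

No definition, no named fact, no sorry.

References: Kleiman1968AlgebraicCycles (Thm. 2.9), Grothendieck1968 (§3 p. 196: "`B(X) ⇒ A(X)`", "`A(X × X) ⇒ B(X)`"),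
Kleiman1994StandardConjectures (Thm. 4-1), Andre1996Motifs (§1.3 (p. 12), §2.1 (p. 15)), VoisinHodgeII2003 (proof of
Thm. 10.17 (10.7)), HatcherAT2002 (§3.2 Prop. 3.10, Thm. 3.11), FultonYoungTableaux1997 (Appendix B §B.1 (5)–(6)).
-/

noncomputable section

set_option linter.dupNamespace false

namespace Summit.HodgeConjecture.HodgeConjecture.Ring2.AbelianAll

open CategoryTheory AlgebraicGeometry MonoidalCategory CartesianMonoidalCategory
open Literature.AlgebraicGeometry Literature.AlgebraicGeometry.Motives
open Literature.AlgebraicGeometry.HodgeTheory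
open Literature.AlgebraicTopology.SingularHomology Literature.Geometry.Kaehler
open Summit.HodgeConjecture.HodgeConjecture.Theorems


/-! ## §1 Correspondences on `X × X`: cross products in mismatched degrees, the Künneth lowering, the diagonal -/

section Square

variable {m n : ℕ} {W X : SchemeOver ℂ}

/-- A cross product `pr_W^* x ∪ pr_X^* y`, `y ∈ Hᵏ(X(ℂ))`, acts by zero on `Hᵃ(X(ℂ))` unless `a + k = 2 dim X`:
`(x ⊠ y)_* c = ± x ∪ pr_{W*} pr_X^* (c ∪ y)` and `pr_{W*} pr_X^*` vanishes off the top degree of `X` (base change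
`pr_{W*} pr_X^* = p_W^* p_{X*}` through the point, the tree's `complexGysin_cup_map_eq_zero_of_lt`; above the top degree
`c ∪ y = 0`). [cite: VoisinHodgeII2003, proof of Thm. 10.17 (10.7)] [cite: FultonYoungTableaux1997, Appendix B (6)] -/
theorem corrAction_cross_eq_zero_of_ne (hW : IsSmoothProjective m W) (hX : IsSmoothProjective n X)
    {i k e a b : ℕ} (hik : i + k = 2 * e) (hab : a + 2 * e = b + 2 * n) (hne : a + k ≠ 2 * n)
    (x : complexBetti W i) (y : complexBetti X k) (c : complexBetti X a) :
    corrAction complexOrientationFamily hW hX hab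
        (cupProduct hik (complexBetti.map (fst W X) i x) (complexBetti.map (snd W X) k y)) c = 0 := by
  rw [corrAction_apply, ← cupProduct_assoc (show a + i = a + i from rfl) hik (show a + i + k = a + 2 * e by omega) rfl,
    cupProduct_gradedComm_holds ℂ _ (show a + i = a + i from rfl) (show i + a = a + i by omega)
      (complexBetti.map (snd W X) a c) (complexBetti.map (fst W X) i x), LinearMap.map_smul₂, map_smul,
    cupProduct_assoc (show i + a = a + i by omega) (show a + k = a + k from rfl) (show a + i + k = a + 2 * e by omega)
      (show i + (a + k) = a + 2 * e by omega), ← complexBetti.map_cupProduct]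
  rcases Nat.lt_or_gt_of_ne hne with hlt | hgt
  · rw [complexGysin_cup_map_eq_zero_of_lt (hW.tensor_holds hX) hW (fst W X) (show i + (a + k) = a + 2 * e by omega)
      (corrAction_degree m hab) (show a + k + 2 * m < 2 * (m + n) by omega), smul_zero]
  · haveI := subsingleton_complexBetti hX hgt
    rw [Subsingleton.elim (cupProduct (show a + k = a + k from rfl) c y) 0, map_zero, map_zero, map_zero, smul_zero]

/-- **The Künneth lowering `Λ ⊗ 1 + 1 ⊗ Λ` acts on correspondences by `γ ↦ Λ ∘ γ_* + γ_* ∘ Λ`** when `Λ` is cup-self-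
adjoint in complementary degrees (part (1) §3): for `γ ∈ H^{2e}((X ⊗ X)(ℂ); ℂ)` and `c ∈ Hᵃ(X(ℂ); ℂ)`,
`(Λ_{X×X} γ)_* c = Λ (γ_* c) + γ_* (Λ c)` as maps `Hᵃ → H^{b-2}` (`a + 2e = b + 2n`). On a cross product `x ⊠ y` the
Künneth lowering is `Λx ⊠ y + x ⊠ Λy` (`exists_kunnethLowering`), `(x ⊠ y)_* c = ± τ(c ∪ y) x` (`exists_crossFunctional`),
and `τ(c ∪ Λ y) = τ(Λ c ∪ y)` is the self-adjointness; Künneth span induction does the rest. This is the mechanism of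
Kleiman 1968 Thm. 2.9 ("`Λ ⊗ 1 + 1 ⊗ Λ` is algebraic on `X × X`, hence so is its value on the diagonal").
[cite: Kleiman1968AlgebraicCycles, Thm. 2.9] [cite: VoisinHodgeII2003, proof of Thm. 10.17 (10.7)] -/
theorem corrAction_kunnethLowering (hX : IsSmoothProjective n X)
    (Λ : (a b : ℕ) → complexBetti X a →ₗ[ℂ] complexBetti X b)
    (hSA : ∀ {a a' k k' : ℕ} (_ : a' + 2 = a) (_ : k' + 2 = k) (h₁ : a + k' = 2 * n) (h₂ : a' + k = 2 * n)
      (c : complexBetti X a) (y : complexBetti X k), cupProduct h₁ c (Λ k k' y) = cupProduct h₂ (Λ a a' c) y)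
    (Λ₂ : (m m' : ℕ) → complexBetti (X ⊗ X) m →ₗ[ℂ] complexBetti (X ⊗ X) m')
    (hΛ : ∀ (i j m m' i' j' : ℕ) (h : i + j = m) (_ : i' + 2 = i) (_ : j' + 2 = j) (h₁ : i' + j = m')
      (h₂ : i + j' = m') (a : complexBetti X i) (b : complexBetti X j),
      Λ₂ m m' (cupProduct h (complexBetti.map (fst X X) i a) (complexBetti.map (snd X X) j b)) =
        cupProduct h₁ (complexBetti.map (fst X X) i' (Λ i i' a)) (complexBetti.map (snd X X) j b) +
          cupProduct h₂ (complexBetti.map (fst X X) i a) (complexBetti.map (snd X X) j' (Λ j j' b)))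
    (hΛl : ∀ (i j m m' j' : ℕ) (h : i + j = m) (_ : m' + 2 = m) (_ : i ≤ 1) (_ : j' + 2 = j) (h₂ : i + j' = m')
      (a : complexBetti X i) (b : complexBetti X j),
      Λ₂ m m' (cupProduct h (complexBetti.map (fst X X) i a) (complexBetti.map (snd X X) j b)) =
        cupProduct h₂ (complexBetti.map (fst X X) i a) (complexBetti.map (snd X X) j' (Λ j j' b)))
    (hΛr : ∀ (i j m m' i' : ℕ) (h : i + j = m) (_ : m' + 2 = m) (_ : i' + 2 = i) (_ : j ≤ 1) (h₁ : i' + j = m')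
      (a : complexBetti X i) (b : complexBetti X j),
      Λ₂ m m' (cupProduct h (complexBetti.map (fst X X) i a) (complexBetti.map (snd X X) j b)) =
        cupProduct h₁ (complexBetti.map (fst X X) i' (Λ i i' a)) (complexBetti.map (snd X X) j b))
    (hΛ0 : ∀ (i j m m' : ℕ) (h : i + j = m) (_ : m' + 2 = m) (_ : i ≤ 1) (_ : j ≤ 1)
      (a : complexBetti X i) (b : complexBetti X j),
      Λ₂ m m' (cupProduct h (complexBetti.map (fst X X) i a) (complexBetti.map (snd X X) j b)) = 0)
    {e e' a a' b b' : ℕ} (he : e' + 1 = e) (ha : a' + 2 = a) (hb : b' + 2 = b) (hab : a + 2 * e = b + 2 * n)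
    (hab' : a + 2 * e' = b' + 2 * n) (ha'b' : a' + 2 * e = b' + 2 * n) (γ : complexBetti (X ⊗ X) (2 * e))
    (c : complexBetti X a) :
    corrAction complexOrientationFamily hX hX hab' (Λ₂ (2 * e) (2 * e') γ) c =
      Λ b b' (corrAction complexOrientationFamily hX hX hab γ c) +
        corrAction complexOrientationFamily hX hX ha'b' γ (Λ a a' c) := by
  obtain ⟨τ, -, hτ⟩ := exists_crossFunctional hX hX
  have hZ := fun {i k e₁ a₁ b₁ : ℕ} (hik : i + k = 2 * e₁) (hab : a₁ + 2 * e₁ = b₁ + 2 * n) (hne : a₁ + k ≠ 2 * n)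
    (x : complexBetti X i) (y : complexBetti X k) (c : complexBetti X a₁) ↦
    corrAction_cross_eq_zero_of_ne hX hX hik hab hne x y c
  have hs1 : ∀ p q : ℕ, (-1 : ℂ) ^ ((p + 2) * q) = (-1) ^ (p * q) := fun p q ↦ by
    rw [add_mul, pow_add, pow_mul (-1 : ℂ) 2 q, neg_one_sq, one_pow, mul_one]
  have hs2 : ∀ p q : ℕ, (-1 : ℂ) ^ (p * (q + 2)) = (-1) ^ (p * q) := fun p q ↦ by
    rw [mul_add, pow_add, mul_comm p 2, pow_mul (-1 : ℂ) 2 p, neg_one_sq, one_pow, mul_one]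
  subst ha hb he
  -- above the top degree of `X` there is nothing to prove
  by_cases hca : 2 * n < a' + 2
  · haveI := subsingleton_complexBetti hX hca
    rw [Subsingleton.elim c 0, map_zero, map_zero, map_zero, map_zero, map_zero, add_zero]
  induction γ using kunneth_span_induction hX hX with
  | h0 => simp
  | hadd x y hx hy => simp only [map_add, LinearMap.add_apply, hx, hy]; abel
  | hsmul r x hx => simp only [map_smul, LinearMap.smul_apply, hx, smul_add]
  | hcross i k hik x y =>
    by_cases hi2 : 2 ≤ i <;> by_cases hk2 : 2 ≤ k
    · -- `i, k ≥ 2`: `Λ₂ (x ⊠ y) = Λx ⊠ y + x ⊠ Λy`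
      obtain ⟨i₀, rfl⟩ : ∃ i₀, i = i₀ + 2 := ⟨i - 2, by omega⟩
      obtain ⟨k₀, rfl⟩ : ∃ k₀, k = k₀ + 2 := ⟨k - 2, by omega⟩
      rw [hΛ (i₀ + 2) (k₀ + 2) _ (2 * e') i₀ k₀ hik rfl rfl (by omega) (by omega) x y, map_add,
        LinearMap.add_apply]
      by_cases hA : a' + 2 + (k₀ + 2) = 2 * n
      · obtain rfl : b' = i₀ := by omega
        rw [hτ (show b' + (k₀ + 2) = 2 * e' by omega) hab' hA, hZ _ hab' (by omega), hτ hik hab hA, map_smul,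
          hZ hik ha'b' (by omega), add_zero, add_zero, hs2]
      · by_cases hB : a' + (k₀ + 2) = 2 * n
        · obtain rfl : b' = i₀ + 2 := by omega
          rw [hZ _ hab' hA, hτ (show i₀ + 2 + k₀ = 2 * e' by omega) hab' (show a' + 2 + k₀ = 2 * n by omega),
            hZ hik hab hA, map_zero, hτ hik ha'b' hB, hs1, hSA rfl rfl (show a' + 2 + k₀ = 2 * n by omega) hB c y]
        · rw [hZ _ hab' hA, hZ _ hab' (by omega), hZ hik hab hA, map_zero, hZ hik ha'b' hB, add_zero]
    · -- `i ≥ 2`, `k ≤ 1`: `Λ₂ (x ⊠ y) = Λx ⊠ y`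
      obtain ⟨i₀, rfl⟩ : ∃ i₀, i = i₀ + 2 := ⟨i - 2, by omega⟩
      rw [hΛr (i₀ + 2) k _ (2 * e') i₀ hik (by omega) rfl (by omega) (by omega) x y]
      by_cases hA : a' + 2 + k = 2 * n
      · obtain rfl : b' = i₀ := by omega
        rw [hτ (show b' + k = 2 * e' by omega) hab' hA, hτ hik hab hA, map_smul, hZ hik ha'b' (by omega), add_zero,
          hs2]
      · rw [hZ _ hab' hA, hZ hik hab hA, map_zero, hZ hik ha'b' (by omega), add_zero]
    · -- `i ≤ 1`, `k ≥ 2`: `Λ₂ (x ⊠ y) = x ⊠ Λy`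
      obtain ⟨k₀, rfl⟩ : ∃ k₀, k = k₀ + 2 := ⟨k - 2, by omega⟩
      rw [hΛl i (k₀ + 2) _ (2 * e') k₀ hik (by omega) (by omega) rfl (by omega) x y]
      by_cases hB : a' + (k₀ + 2) = 2 * n
      · obtain rfl : b' = i := by omega
        rw [hτ (show b' + k₀ = 2 * e' by omega) hab' (show a' + 2 + k₀ = 2 * n by omega), hZ hik hab (by omega),
          map_zero, hτ hik ha'b' hB, zero_add, hs1, hSA rfl rfl (show a' + 2 + k₀ = 2 * n by omega) hB c y]
      · rw [hZ _ hab' (by omega), hZ hik hab (by omega), map_zero, hZ hik ha'b' hB, add_zero]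
    · -- `i, k ≤ 1`: `Λ₂ (x ⊠ y) = 0`
      rw [hΛ0 i k _ (2 * e') hik (by omega) (by omega) (by omega) x y, map_zero, LinearMap.zero_apply,
        hZ hik hab (by omega), map_zero, hZ hik ha'b' (by omega), add_zero]

/-- **The diagonal acts as the identity**: `[Δ]_* c = c` for the class `[Δ] = (𝟙, 𝟙)_* 1 ∈ H²ⁿ((X ⊗ X)(ℂ); ℂ)` of
the diagonal of a smooth projective `X` of dimension `n` and `c ∈ Hᵃ(X(ℂ); ℂ)`, `a ≤ 2n` (the tree's
`corrClassAction_graph` for `f = 𝟙`). [cite: Andre1996Motifs, §2.1 (p. 15)]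
[cite: FultonYoungTableaux1997, Appendix B §B.1 (5)–(6)] -/
theorem corrAction_diagonal (hX : IsSmoothProjective n X) {a : ℕ} (ha : a ≤ 2 * n) (c : complexBetti X a) :
    corrAction complexOrientationFamily hX hX (rfl : a + 2 * n = a + 2 * n)
        (complexGysin complexOrientationFamily hX (hX.tensor_holds hX) (lift (𝟙 X) (𝟙 X))
          (show 0 + 2 * (n + n) = 2 * n + 2 * n by omega) (singularCohomology.one ℂ (ComplexPoints X))) c = c := by
  rw [corrAction_eq_corrClassAction complexOrientationFamily hX hX rfl (show a + (2 * n - a) = 2 * n by omega),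
    corrClassAction_graph complexOrientationFamily hasPoincareDuality_complexOrientationFamily hX (hX.tensor_holds hX)
      (𝟙 X) _ c, complexBetti.map_id]
  rfl

end Square

/-! ## §2 `A(X × X, η ⊠ 1 + 1 ⊠ η) ⇒ B⋆(X)` on the real carriers -/

section Main

variable {n : ℕ} {X : SchemeOver ℂ}

/-- **KLEIMAN 1968 THM. 2.9, THE `A ⇒ B` HALF, ON THE REAL CARRIERS (RING2 letter circle `A(all) ⟺ B⋆(all)`,
the node "in print, not in tree"):** for a smooth projective `X/ℂ` of dimension `n` with a polarisation class `η`
(rational, divisor class, hard Lefschetz), Grothendieck's standard conjecture `A(X × X, L_θ)` for the product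
polarisation `θ = η ⊠ 1 + 1 ⊠ η` — `L_θ^{2n-2p}` maps `Nᵖ H²ᵖ(X × X)` ONTO `N^{2n-p} H^{4n-2p}(X × X)` — implies André's
sign-free Lefschetz standard conjecture `B⋆(X)`: every `*_{L,η} : Hᵃ → H²ⁿ⁻ᵃ` is an algebraic correspondence.
PROOF (Kleiman's, ported to `complexBetti`): let `Λ` be the lowering operator of `η` (`exists_sl2Lowering`) and
`Λ₁₂ = Λ ⊗ 1 + 1 ⊗ Λ` its Künneth lift (`exists_kunnethLowering`), which satisfies `[L_θ, Λ₁₂] = deg - 2n`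
(`prod_sl2_lefschetz_lowering_sub`); by part (1) §2, `A(X × X, θ)` makes `Λ₁₂` preserve algebraic classes of `X × X`;
the diagonal `[Δ]` is algebraic and `(Λ₁₂ [Δ])_* = Λ ∘ [Δ]_* + [Δ]_* ∘ Λ = 2Λ` (§1, `Λ` being cup-self-adjoint, part (1)
§3), so `Λ = ½ (Λ₁₂[Δ])_*` is algebraic in every degree; hence so are its iterates `Λʳ`, which are injective
`H^{n+r} → H^{n-r}` (part (1) §4), and the `ν`-criterion `standardConjectureBStar_of_nu` (XXII-b) gives `B⋆(X)`. With the
tree's `standardConjectureA_of_standardConjectureBStar` (part XIV, the converse on one variety) this closes the letter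
circle `(∀ X, A(X)) ⟺ (∀ X, B⋆(X))` of Grothendieck §3 p. 196 on the real carriers (next theorem); no case of the Hodge
conjecture and no standard conjecture is proved here. [cite: Kleiman1968AlgebraicCycles, Thm. 2.9]
[cite: Grothendieck1968, §3 p. 196] [cite: Kleiman1994StandardConjectures, Thm. 4-1] [cite: Andre1996Motifs, §1.3 (p. 12)] -/
theorem standardConjectureBStar_of_standardConjectureA_tensor_self (hX : IsSmoothProjective n X)
    {η : complexBetti X 2} (hη : IsPolarizationClass n X η)
    (hA : StandardConjectureA (n + n) (X ⊗ X) (complexBetti.map (fst X X) 2 η + complexBetti.map (snd X X) 2 η)) :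
    StandardConjectureBStar n X η := by
  have hXX : IsSmoothProjective (n + n) (X ⊗ X) := hX.tensor_holds hX
  have hvan : ∀ m, 2 * n < m → Subsingleton (complexBetti X m) := fun m hm ↦ subsingleton_complexBetti hX hm
  have hL := hη.hasHardLefschetz
  obtain ⟨Λ, -, hS, hP⟩ := exists_sl2Lowering hL hvan
  obtain ⟨Λ₂, hΛ, hΛl, hΛr, hΛ0⟩ := exists_kunnethLowering hX hX Λ Λ
  set θ := complexBetti.map (fst X X) 2 η + complexBetti.map (snd X X) 2 η with hθ
  -- the `𝔰𝔩₂` relation of `Λ₁₂` for `L_θ` in dimension `n + n`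
  have hR : ∀ {c d e : ℕ} (hcd : c + 2 * 1 = d) (hde : d + 2 * 1 = e) (y : complexBetti (X ⊗ X) d),
      lefschetzPowTo θ 1 c d hcd (Λ₂ d c y) - Λ₂ e d (lefschetzPowTo θ 1 d e hde y) =
        ((((d : ℤ) - (n + n : ℕ)) : ℤ) : ℂ) • y := by
    intro c d e hcd hde y
    rw [prod_sl2_lefschetz_lowering_sub hvan hvan Λ hS hP Λ hS hP Λ₂ hΛ hΛl hΛr hΛ0 hX hX hL hL hcd hde y]
    congr 1
    push_cast
    ring
  have hR₁ : ∀ {d e : ℕ} (_ : d ≤ 1) (hde : d + 2 * 1 = e) (y : complexBetti (X ⊗ X) d),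
      Λ₂ e d (lefschetzPowTo θ 1 d e hde y) = (((((n + n : ℕ) : ℤ) - d) : ℤ) : ℂ) • y := by
    intro d e hd hde y
    rw [prod_sl2_lowering_lefschetz_of_le_one hvan hvan Λ hS Λ hS Λ₂ hΛl hΛr hX hX hd hde y]
    congr 1
  -- (β) `Λ₁₂` preserves algebraic classes of `X × X`, by `A(X × X, θ)`
  have hθalg : θ ∈ algebraicClasses (X ⊗ X) 1 := (isPolarizationClass_boxSum hX hX hη hη).mem_algebraicClasses
  have hβ := sl2_lowering_mem_algebraicClasses_of_standardConjectureA hXX hθalg hA Λ₂ hR hR₁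
  -- (γ) `Λ = ½ (Λ₁₂ [Δ])_*` is algebraic in every degree
  have hSA : ∀ {a a' k k' : ℕ} (_ : a' + 2 = a) (_ : k' + 2 = k) (h₁ : a + k' = 2 * n) (h₂ : a' + k = 2 * n)
      (c : complexBetti X a) (y : complexBetti X k), cupProduct h₁ c (Λ k k' y) = cupProduct h₂ (Λ a a' c) y :=
    fun ha hk h₁ h₂ c y ↦ sl2Lowering_cupProduct_comm hL hvan Λ hS hP ha hk h₁ h₂ c y
  have hΛalg : ∀ (a a' : ℕ), a' + 2 = a → a ≤ 2 * n → IsAlgebraicCorrespondence n n X X (Λ a a') := by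
    intro a a' ha ha2
    obtain ⟨n', hn'⟩ : ∃ n', n' + 1 = n := ⟨n - 1, by omega⟩
    have hδ := complexGysin_graph_one_mem_algebraicClasses complexOrientationFamily
      hasPoincareDuality_complexOrientationFamily hX hXX (𝟙 X)
    have hab' : a + 2 * n' = a' + 2 * n := by omega
    have h2 : Λ a a' = (1 / 2 : ℂ) • corrAction complexOrientationFamily hX hX hab' (Λ₂ (2 * n) (2 * n')
        (complexGysin complexOrientationFamily hX hXX (lift (𝟙 X) (𝟙 X))
          (show 0 + 2 * (n + n) = 2 * n + 2 * n by omega) (singularCohomology.one ℂ (ComplexPoints X)))) := by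
      refine LinearMap.ext fun c ↦ ?_
      rw [LinearMap.smul_apply, corrAction_kunnethLowering hX Λ hSA Λ₂ hΛ hΛl hΛr hΛ0 hn' ha ha rfl hab' rfl,
        corrAction_diagonal hX ha2 c, corrAction_diagonal hX (by omega) (Λ a a' c), ← two_smul ℂ (Λ a a' c),
        smul_smul]
      norm_num
    rw [h2]
    exact AbelianAll.IsAlgebraicCorrespondence.smul hX hX
      (isAlgebraicCorrespondence_corrAction_complex hX hX hab' (by omega) (hβ n hn' hδ)) _
  -- (δ) the `ν`-criterion with `F = Λʳ`
  exact Hypotheses.standardConjectureBStar_of_nu hX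
    (fun b r _ hbr _ ↦ exists_injective_algebraic_sl2LoweringPow hX hL Λ hS hΛalg hbr) η

/-- **THE LETTER CIRCLE `(∀ X, A(X)) ⟺ (∀ X, B⋆(X))` ON THE REAL CARRIERS** (Grothendieck: "`B(X) ⇒ A(X)`",
"`A(X × X) ⇒ B(X)`"; §AbelianAll implication table, the pair of letters `A`/`B⋆` quantified over all smooth projective
`X/ℂ` with polarisation classes): `⟸` is part XIV's `standardConjectureA_of_standardConjectureBStar` variety by variety;
`⟹` applies `A` to `(X × X, η ⊠ 1 + 1 ⊠ η)` — a polarisation class by b05's `isPolarizationClass_boxSum` — and the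
previous theorem. Both sides are OPEN; this is an equivalence of open statements, not a proof of either.
[cite: Grothendieck1968, §3 p. 196] [cite: Kleiman1968AlgebraicCycles, Thm. 2.9] [cite: Kleiman1994StandardConjectures, Thm. 4-1] -/
theorem forall_standardConjectureA_iff_forall_standardConjectureBStar :
    (∀ (n : ℕ) (X : SchemeOver ℂ) (η : complexBetti X 2), IsSmoothProjective n X → IsPolarizationClass n X η →
        StandardConjectureA n X η) ↔
      ∀ (n : ℕ) (X : SchemeOver ℂ) (η : complexBetti X 2), IsSmoothProjective n X → IsPolarizationClass n X η →
        StandardConjectureBStar n X η :=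
  ⟨fun hA n X _ hX hη ↦ standardConjectureBStar_of_standardConjectureA_tensor_self hX hη
      (hA (n + n) (X ⊗ X) _ (hX.tensor_holds hX) (isPolarizationClass_boxSum hX hX hη hη)),
    fun hB n X η hX hη ↦ standardConjectureA_of_standardConjectureBStar hX hη (hB n X η hX hη)⟩

end Main

end Summit.HodgeConjecture.HodgeConjecture.Ring2.AbelianAll

end
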